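import Literature.GroupTheory.CombinatorialGroupTheory.QuadraticWordsForm
import Mathlib.Logic.Function.Iterate
import Mathlib.Tactic.Linarith
import HarnessLib

/-!
# The vertex cycle of a quadratic word, and nondegeneracy of one-vertex words

Topic `Literature/GroupTheory/CombinatorialGroupTheory`.  An alternating quadratic word `w`
(`QuadraticWords.lean`: every symbol occurs once with each exponent) is the boundary word of a
polygon whose sides are identified in pairs; the identification space is a closed orientable
surface `S(w)` with ONE face, `m` edges (the symbols) and `V` vertices, where the vertices are
the cycles of the **vertex map** on the positions of `w`

  `ρ(k) = (position of the partner letter of the letter BEFORE position k)`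

(reading the corner of the polygon at the start of the `k`-th letter: the side before it is glued
to its partner side, whose start is the next corner around the same vertex of `S(w)`) —
Zieschang–Vogt–Coldewey, *Surfaces and Planar Discontinuous Groups*, LNM 835 (1980), §3.1
(3.1.3–3.1.6: surfaces from polygons with sides identified in pairs, the vertex cycles), and the
genus formula `2 - 2g = V - m + 1` (3.1.8, Euler characteristic).  The word has **one vertex**
(`OneVertex w`) when `ρ` is transitive; these are exactly the words of genus `m / 2`, e.g. the
surface relator `∏ [aᵢ, bᵢ]`.

Main result (`OneVertex.nondeg`): **a one-vertex quadratic word using every symbol has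
nondegenerate intersection form** (`Nondeg`, `QuadraticWordsForm.lean`).  This is the
combinatorial shadow of Poincaré duality for the closed surface `S(w)` (ZVC 3.6.3: the
intersection form of a closed orientable surface is nondegenerate); the proof here is direct:
if `ω(ξ, ·) = 0`, the partial signed `ξ`-sums along the boundary word (a "potential" on the
corners of the polygon) are constant along every vertex cycle (`lsum_take_vertexMap`), hence
constant when there is one vertex, so every letter has weight `0`.  Consequently
(`QuadraticWordsGathering.exists_blocks_of_terminal`, Zieschang's gathering of handles) a
one-vertex word is carried by an automorphism of the free group to the surface relator — see
`QuadraticWordsSurfaceNormalForm.lean`.  This is the normal-form input of the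
Reidemeister–Schreier computation of finite-index subgroups of surface groups (ZVC 4.14.22).

Also: the computation of the form against the indicator of a symbol in the SECOND variable
(`omega_right_single`, companion of `omega_single_interlink`), the positions of the two
occurrences of a symbol (`partnerPos_eq_of_split_left/right`).

## References

* H. Zieschang, E. Vogt, H.-D. Coldewey, *Surfaces and Planar Discontinuous Groups*, LNM 835,
  Springer 1980, §3.1 (3.1.3–3.1.8), §3.6 (3.6.3). [ZieschangVogtColdewey1980]
-/

namespace Literature.GroupTheory.CombinatorialGroupTheory

open List

variable {ι : Type*} [DecidableEq ι]

/-! ### The form against the indicator of a symbol, second variable -/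

omit [DecidableEq ι] in
/-- The combinatorial form vanishes if the second weight vanishes along the word. [folklore] -/
private theorem omegaW_eq_zero_of_forall_right {α β : ι → ℤ} {L : List (ι × Bool)}
    (h : ∀ x ∈ L, β x.1 = 0) : omegaW α β L = 0 := by
  induction L with
  | nil => rfl
  | cons x L ih =>
    have hx := h x mem_cons_self
    have h' : ∀ y ∈ L, β y.1 = 0 := fun y hy => h y (mem_cons_of_mem _ hy)
    have ih' := ih h'
    obtain ⟨i, _ | _⟩ := x
    · simp only [omegaW, ih', lsum_eq_zero_of_forall h']; simp only at hx; rw [hx]; ring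
    · simp only [omegaW, ih', lsum_eq_zero_of_forall h']; ring

omit [DecidableEq ι] in
/-- The Heisenberg evaluation of a word along which the second weight vanishes. [folklore] -/
private theorem heisHom_mk_of_vanish_right (ξ : ι → ℤ) {η : ι → ℤ} {L : List (ι × Bool)}
    (h : ∀ x ∈ L, η x.1 = 0) : heisHom ξ η (FreeGroup.mk L) = ⟨lsum ξ L, 0, 0⟩ :=
  Heis.ext (heisHom_mk_a ξ η L) (by rw [heisHom_mk_b, lsum_eq_zero_of_forall h])
    (by rw [← omega, omega_mk, omegaW_eq_zero_of_forall_right h])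

/-- Along a segment avoiding `p` the indicator weight of `p` vanishes. [folklore] -/
private theorem single_vanish_of_avoids {p : ι} {L : List (ι × Bool)} (h : Avoids p L) :
    ∀ x ∈ L, (Pi.single p (1 : ℤ) : ι → ℤ) x.1 = 0 :=
  fun x hx => Pi.single_eq_of_ne (h x hx) _

/-- **The form against the indicator of a symbol, in the second variable**: for a word
`W₁ z^{(σ)} T z^{(!σ)} W₂` in which `z` occurs nowhere else and any weight `ξ`,
`ω(ξ, 𝟙_z) = ∓ (signed ξ-sum over T)` — the symbols interlinked with `z`, weighted.
[cite: ZieschangVogtColdewey1980, 3.6.1–3.6.3] -/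
theorem omega_right_single (ξ : ι → ℤ) (z : ι) (σ : Bool) (W₁ T W₂ : List (ι × Bool))
    (h₁ : Avoids z W₁) (hT : Avoids z T) (h₂ : Avoids z W₂) :
    omega ξ (Pi.single z 1) (FreeGroup.mk (W₁ ++ (z, σ) :: (T ++ (z, !σ) :: W₂))) =
      -((bif σ then 1 else -1) * lsum ξ T) := by
  rw [omega, mk_append, mk_cons_eq_sgen_mul, mk_append, mk_cons_eq_sgen_mul]
  simp only [map_mul, heisHom_mk_of_vanish_right ξ (single_vanish_of_avoids h₁),
    heisHom_mk_of_vanish_right ξ (single_vanish_of_avoids hT),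
    heisHom_mk_of_vanish_right ξ (single_vanish_of_avoids h₂), heisHom_sgen, Pi.single_eq_same]
  cases σ <;> simp only [cond_true, cond_false, Bool.not_true, Bool.not_false, Heis.mul_b,
    Heis.mul_c] <;> ring

/-- If `ω(ξ, ·) = 0` on a word `W₁ z^{(σ)} T z^{(!σ)} W₂` in which `z` occurs nowhere else, the
signed `ξ`-sum over `T` vanishes. [cite: ZieschangVogtColdewey1980, 3.6.3] -/
theorem lsum_eq_zero_of_omega_eq_zero (ξ : ι → ℤ) {z : ι} {σ : Bool} {W₁ T W₂ : List (ι × Bool)}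
    (h₁ : Avoids z W₁) (hT : Avoids z T) (h₂ : Avoids z W₂)
    (h : omega ξ (Pi.single z 1) (FreeGroup.mk (W₁ ++ (z, σ) :: (T ++ (z, !σ) :: W₂))) = 0) :
    lsum ξ T = 0 := by
  rw [omega_right_single ξ z σ W₁ T W₂ h₁ hT h₂] at h
  cases σ <;> simpa using h

/-! ### Positions, partners, the vertex map -/

/-- The cyclic predecessor of a position `k < n`: `k - 1`, and `n - 1` for `k = 0`.
[cite: ZieschangVogtColdewey1980, 3.1.3] -/
def predPos {n : ℕ} (k : Fin n) : Fin n := ⟨(k.val + (n - 1)) % n, Nat.mod_lt _ k.pos⟩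

/-- The predecessor of a positive position. [cite: ZieschangVogtColdewey1980, 3.1.3] -/
theorem predPos_val_of_pos {n : ℕ} (k : Fin n) (hk : 0 < k.val) : (predPos k).val = k.val - 1 := by
  have hn := k.pos
  have hk' := k.isLt
  simp only [predPos]
  have e : k.val + (n - 1) = (k.val - 1) + n := by omega
  rw [e, Nat.add_mod_right, Nat.mod_eq_of_lt (by omega)]

/-- The predecessor of position `0` is the last position. [cite: ZieschangVogtColdewey1980, 3.1.3] -/
theorem predPos_val_of_eq_zero {n : ℕ} (k : Fin n) (hk : k.val = 0) : (predPos k).val = n - 1 := by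
  have hn := k.pos
  simp only [predPos, hk, zero_add]
  exact Nat.mod_eq_of_lt (by omega)

/-- **The partner position** of position `k` of a word `w`: the position of the other occurrence
of the same symbol, with the opposite exponent (the side of the polygon glued to side `k`).  Total
by reduction mod `|w|`; meaningful for alternating quadratic words. [cite: ZieschangVogtColdewey1980, 3.1.3] -/
def partnerPos (w : List (ι × Bool)) (k : Fin w.length) : Fin w.length :=
  ⟨w.idxOf ((w.get k).1, !(w.get k).2) % w.length, Nat.mod_lt _ k.pos⟩

/-- **The vertex map** `ρ` of a word on its positions: `ρ(k)` is the partner position of the letter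
preceding position `k` (cyclically).  Its cycles are the vertices of the surface obtained from the
polygon with boundary word `w` by gluing partner sides. [cite: ZieschangVogtColdewey1980, 3.1.3–3.1.6] -/
def vertexMap (w : List (ι × Bool)) (k : Fin w.length) : Fin w.length := partnerPos w (predPos k)

/-- **One-vertex words**: the vertex map is transitive on positions, i.e. the surface of the word
has exactly one vertex (for a nonempty word). [cite: ZieschangVogtColdewey1980, 3.1.6, 3.1.8] -/
def OneVertex (w : List (ι × Bool)) : Prop :=
  ∀ k l : Fin w.length, ∃ m : ℕ, (vertexMap w)^[m] k = l

/-! ### The two occurrences of a symbol -/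

omit [DecidableEq ι] in
/-- A letter with symbol `y` is not in a segment avoiding `y`. [folklore] -/
private theorem not_mem_of_avoids {y : ι} {s : Bool} {L : List (ι × Bool)} (h : Avoids y L) : (y, s) ∉ L :=
  fun hm => h _ hm rfl

/-- In `A ++ (y,s) :: (T ++ (y,!s) :: C)` with `A`, `T` avoiding `y`, the position of `(y, !s)` is
`|A| + 1 + |T|`. [folklore] -/
private theorem idxOf_partner_of_split {y : ι} {s : Bool} {A T C : List (ι × Bool)}
    (hA : Avoids y A) (hT : Avoids y T) :
    (A ++ (y, s) :: (T ++ (y, !s) :: C)).idxOf (y, !s) = A.length + 1 + T.length := by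
  have hne : (y, s) ≠ (y, !s) := fun h => by cases s <;> cases h
  rw [idxOf_append_of_notMem (not_mem_of_avoids hA), idxOf_cons_ne _ hne,
    idxOf_append_of_notMem (not_mem_of_avoids hT), idxOf_cons_self]
  omega

/-- In `A ++ (y,s) :: B` with `A` avoiding `y`, the position of `(y, s)` is `|A|`. [folklore] -/
private theorem idxOf_self_of_split {y : ι} {s : Bool} {A B : List (ι × Bool)} (hA : Avoids y A) :
    (A ++ (y, s) :: B).idxOf (y, s) = A.length := by
  rw [idxOf_append_of_notMem (not_mem_of_avoids hA), idxOf_cons_self, Nat.add_zero]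

omit [DecidableEq ι] in
/-- The letter at position `|A|` of `A ++ x :: B` is `x`. [folklore] -/
private theorem get_of_split {A B : List (ι × Bool)} {x : ι × Bool} {w : List (ι × Bool)}
    (hw : w = A ++ x :: B) (h : A.length < w.length) : w.get ⟨A.length, h⟩ = x := by
  subst hw
  simp

/-- **Partner of the first occurrence.**  In `w = A ++ (y,s) :: (T ++ (y,!s) :: C)` with `A`, `T`
avoiding `y`, the partner position of `|A|` is `|A| + 1 + |T|`. [cite: ZieschangVogtColdewey1980, 3.1.3] -/
theorem partnerPos_eq_of_split_left {w A T C : List (ι × Bool)} {y : ι} {s : Bool}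
    (hw : w = A ++ (y, s) :: (T ++ (y, !s) :: C)) (hA : Avoids y A) (hT : Avoids y T)
    (h : A.length < w.length) :
    (partnerPos w ⟨A.length, h⟩).val = A.length + 1 + T.length := by
  have hlen : w.length = A.length + 1 + T.length + 1 + C.length := by
    rw [hw]; simp only [length_append, length_cons]; omega
  simp only [partnerPos, get_of_split hw h]
  rw [hw, idxOf_partner_of_split hA hT, ← hw, Nat.mod_eq_of_lt (by omega)]

/-- **Partner of the second occurrence.**  In `w = A ++ (y,s) :: (T ++ (y,!s) :: C)` with `A`
avoiding `y`, the partner position of `|A| + 1 + |T|` is `|A|`. [cite: ZieschangVogtColdewey1980, 3.1.3] -/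
theorem partnerPos_eq_of_split_right {w A T C : List (ι × Bool)} {y : ι} {s : Bool}
    (hw : w = A ++ (y, s) :: (T ++ (y, !s) :: C)) (hA : Avoids y A)
    (h : A.length + 1 + T.length < w.length) :
    (partnerPos w ⟨A.length + 1 + T.length, h⟩).val = A.length := by
  have hw' : w = (A ++ (y, s) :: T) ++ (y, !s) :: C := by rw [hw]; simp
  have hl : (A ++ (y, s) :: T).length = A.length + 1 + T.length := by
    simp only [length_append, length_cons]; omega
  have hget : w.get ⟨A.length + 1 + T.length, h⟩ = (y, !s) := by
    have := get_of_split hw' (hl ▸ h)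
    simpa [hl] using this
  simp only [partnerPos, hget, Bool.not_not]
  rw [hw, idxOf_self_of_split hA, ← hw, Nat.mod_eq_of_lt (by omega)]

/-! ### The potential along the boundary is constant on vertex cycles -/

section Potential

variable {w : List (ι × Bool)}

omit [DecidableEq ι] in
/-- Splitting a word at a position: `w = take j ++ w[j] :: drop (j+1)`. [folklore] -/
private theorem eq_take_append_get_cons_drop (w : List (ι × Bool)) (j : Fin w.length) :
    w = w.take j ++ w.get j :: w.drop (j + 1) := by
  conv_lhs => rw [← take_append_drop j w]
  rw [get_eq_getElem, getElem_cons_drop]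

/-- **The potential is constant along vertex cycles.**  If `w` is alternating quadratic and
`ω(ξ, 𝟙_z) = 0` for every symbol `z`, then the signed `ξ`-sum of the first `k` letters of `w` is
unchanged when `k` is replaced by `ρ(k)`. [cite: ZieschangVogtColdewey1980, 3.6.3] -/
theorem lsum_take_vertexMap [Fintype ι] (hq : IsQuadratic w) (ξ : ι → ℤ)
    (hξ : ∀ z : ι, omega ξ (Pi.single z 1) (FreeGroup.mk w) = 0) (k : Fin w.length) :
    lsum ξ (w.take (vertexMap w k)) = lsum ξ (w.take k) := by
  have hn : 0 < w.length := k.pos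
  have htot : lsum ξ w = 0 := hq.isBalanced.lsum_eq_zero ξ
  -- the letter before position `k`, and the word split there
  set j : Fin w.length := predPos k with hj
  obtain ⟨⟨y, s⟩, hx⟩ : ∃ x : ι × Bool, w.get j = x := ⟨_, rfl⟩
  set A := w.take j with hA
  set B := w.drop (j + 1) with hB
  have hw : w = A ++ (y, s) :: B := by rw [hA, hB, ← hx]; exact eq_take_append_get_cons_drop w j
  have hAl : A.length = j := by rw [hA, length_take]; exact min_eq_left (le_of_lt j.isLt)
  have hjA : (⟨A.length, hAl ▸ j.isLt⟩ : Fin w.length) = j := Fin.ext hAl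
  -- `vertexMap w k = partnerPos w j`
  have hρ : vertexMap w k = partnerPos w j := rfl
  -- relation between `k` and `j`
  have hk : (k.val = 0 ∧ j.val = w.length - 1) ∨ (0 < k.val ∧ j.val = k.val - 1) := by
    by_cases h0 : k.val = 0
    · exact Or.inl ⟨h0, predPos_val_of_eq_zero k h0⟩
    · exact Or.inr ⟨Nat.pos_of_ne_zero h0, predPos_val_of_pos k (Nat.pos_of_ne_zero h0)⟩
  -- the partner letter `(y, !s)` lies in `B` or in `A`
  have hym : (y, s) ∈ w := by rw [hw]; exact mem_append_right _ mem_cons_self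
  have hpm : (y, !s) ∈ A ++ (y, s) :: B := hw ▸ hq.partner_mem hym
  have hne : (y, !s) ≠ (y, s) := fun h => by cases s <;> cases h
  rcases mem_append.1 hpm with hpA | hpB
  · -- second case: the partner comes FIRST, `w = W₁ (y,!s) T (y,s) B`
    obtain ⟨W₁, T, hAeq⟩ := append_of_mem hpA
    have hw2 : w = W₁ ++ (y, !s) :: (T ++ (y, !!s) :: B) := by rw [hw, hAeq]; simp
    obtain ⟨hW₁, hTav, hBav⟩ := (hw2 ▸ hq).avoids_of_split
    have hT0 : lsum ξ T = 0 := lsum_eq_zero_of_omega_eq_zero ξ hW₁ hTav hBav (hw2 ▸ hξ y)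
    have hjval : j.val = W₁.length + 1 + T.length := by
      rw [← hAl, hAeq]; simp only [length_append, length_cons]; omega
    have hjW : j = ⟨W₁.length + 1 + T.length, hjval ▸ j.isLt⟩ := Fin.ext hjval
    have hρv : (vertexMap w k).val = W₁.length := by
      rw [hρ, hjW]; exact partnerPos_eq_of_split_right hw2 hW₁ _
    have htake : w.take (vertexMap w k) = W₁ := by
      rw [hρv]; conv_lhs => rw [hw2]
      exact take_left' rfl
    rw [htake]
    rcases hk with ⟨hk0, hjl⟩ | ⟨hkpos, hjk⟩
    · -- `k = 0`: the letter before is the last one, `B = []`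
      have hB0 : B = [] := by
        apply List.eq_nil_of_length_eq_zero
        have : w.length = A.length + 1 + B.length := by
          conv_lhs => rw [hw]
          simp only [length_append, length_cons]; omega
        omega
      have hsum : lsum ξ w = lsum ξ W₁ + lsum ξ T := by
        conv_lhs => rw [hw2, hB0]
        simp only [lsum_append, lsum_cons, Bool.not_not, hT0]
        cases s <;> simp
      have : w.take k = [] := by rw [hk0, take_zero]
      rw [this, lsum_nil]
      linarith [hsum, htot, hT0]
    · -- `k = j + 1`
      have hkv : k.val = W₁.length + 1 + T.length + 1 := by omega
      have htk : w.take k = W₁ ++ (y, !s) :: (T ++ [(y, !!s)]) := by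
        rw [show (k : ℕ) = (W₁ ++ (y, !s) :: (T ++ [(y, !!s)])).length by
          rw [hkv]; simp only [length_append, length_cons, length_nil]; omega]
        conv_lhs => rw [hw2]
        rw [show W₁ ++ (y, !s) :: (T ++ (y, !!s) :: B) = (W₁ ++ (y, !s) :: (T ++ [(y, !!s)])) ++ B by simp]
        exact take_left' rfl
      rw [htk]
      simp only [lsum_append, lsum_cons, lsum_nil, Bool.not_not, hT0]
      cases s <;> simp
  · rcases mem_cons.1 hpB with hpx | hpB'
    · exact absurd hpx hne
    -- first case: the partner comes SECOND, `w = A (y,s) T (y,!s) C`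
    obtain ⟨T, C, hBeq⟩ := append_of_mem hpB'
    have hw1 : w = A ++ (y, s) :: (T ++ (y, !s) :: C) := by rw [hw, hBeq]
    obtain ⟨hAav, hTav, hCav⟩ := (hw1 ▸ hq).avoids_of_split
    have hT0 : lsum ξ T = 0 := lsum_eq_zero_of_omega_eq_zero ξ hAav hTav hCav (hw1 ▸ hξ y)
    have hρv : (vertexMap w k).val = A.length + 1 + T.length := by
      rw [hρ, ← hjA]; exact partnerPos_eq_of_split_left hw1 hAav hTav _
    have htake : w.take (vertexMap w k) = A ++ (y, s) :: T := by
      rw [hρv]; conv_lhs => rw [hw1]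
      rw [show A ++ (y, s) :: (T ++ (y, !s) :: C) = (A ++ (y, s) :: T) ++ (y, !s) :: C by simp]
      exact take_left' (by simp only [length_append, length_cons]; omega)
    rw [htake]
    rcases hk with ⟨hk0, hjl⟩ | ⟨hkpos, hjk⟩
    · -- `k = 0` is impossible here: the last letter has no letter after it
      exfalso
      have : w.length = A.length + 1 + (T.length + 1 + C.length) := by
        conv_lhs => rw [hw1]
        simp only [length_append, length_cons]; omega
      omega
    · have hkv : k.val = A.length + 1 := by omega
      have htk : w.take k = A ++ [(y, s)] := by
        rw [show (k : ℕ) = (A ++ [(y, s)]).length by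
          rw [hkv]; simp only [length_append, length_cons, length_nil]]
        conv_lhs => rw [hw]
        rw [show A ++ (y, s) :: B = (A ++ [(y, s)]) ++ B by simp]
        exact take_left' rfl
      rw [htk]
      simp only [lsum_append, lsum_cons, lsum_nil, hT0, add_zero]

/-- The potential is constant along the orbits of the vertex map. [cite: ZieschangVogtColdewey1980, 3.6.3] -/
theorem lsum_take_iterate_vertexMap [Fintype ι] (hq : IsQuadratic w) (ξ : ι → ℤ)
    (hξ : ∀ z : ι, omega ξ (Pi.single z 1) (FreeGroup.mk w) = 0) (m : ℕ) (k : Fin w.length) :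
    lsum ξ (w.take ((vertexMap w)^[m] k)) = lsum ξ (w.take k) := by
  induction m with
  | zero => rfl
  | succ m ih => rw [Function.iterate_succ_apply', lsum_take_vertexMap hq ξ hξ, ih]

end Potential

/-! ### One-vertex words are nondegenerate -/

/-- **A one-vertex alternating quadratic word in which every symbol occurs has nondegenerate
form** (combinatorial Poincaré duality for the closed surface of the word: ZVC 3.6.3 with 3.1.8).
If `ω(ξ, ·) = 0` then the potential `k ↦ Σ_{j<k} ±ξ` is constant on the single vertex cycle, so
every letter has weight `0` and `ξ = 0`. [cite: ZieschangVogtColdewey1980, 3.6.3] -/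
theorem OneVertex.nondeg [Fintype ι] {w : List (ι × Bool)} (hV : OneVertex w)
    (hq : IsQuadratic w) (hall : ∀ i, (i, true) ∈ w) : Nondeg w := by
  intro ξ hξ0
  by_contra H
  apply hξ0
  funext i
  have hξ : ∀ z : ι, omega ξ (Pi.single z 1) (FreeGroup.mk w) = 0 := fun z => by
    by_contra h
    exact H ⟨_, h⟩
  have htot : lsum ξ w = 0 := hq.isBalanced.lsum_eq_zero ξ
  -- the potential is constant on positions
  have hconst : ∀ k l : Fin w.length, lsum ξ (w.take k) = lsum ξ (w.take l) := by
    intro k l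
    obtain ⟨m, rfl⟩ := hV k l
    exact (lsum_take_iterate_vertexMap hq ξ hξ m k).symm
  -- hence every step of the potential vanishes
  have hstep : ∀ p : ℕ, p < w.length → lsum ξ (w.take (p + 1)) = lsum ξ (w.take p) := by
    intro p hp
    by_cases h : p + 1 < w.length
    · exact hconst ⟨p + 1, h⟩ ⟨p, hp⟩
    · have hpe : p + 1 = w.length := by omega
      rw [hpe, take_length, htot, hconst ⟨p, hp⟩ ⟨0, by omega⟩, take_zero, lsum_nil]
  -- the letter `(i, true)` has weight `ξ i`
  obtain ⟨A, B, hw⟩ := append_of_mem (hall i)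
  have hp : A.length < w.length := by rw [hw]; simp
  have h1 : w.take (A.length + 1) = A ++ [(i, true)] := by
    conv_lhs => rw [hw]
    rw [show A ++ (i, true) :: B = (A ++ [(i, true)]) ++ B by simp]
    exact take_left' (by simp)
  have h0 : w.take A.length = A := by
    conv_lhs => rw [hw]
    exact take_left' rfl
  have := hstep A.length hp
  rw [h1, h0, lsum_append, lsum_cons, lsum_nil] at this
  simpa using this

end Literature.GroupTheory.CombinatorialGroupTheory
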